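import Summits.QuantumFields.YangMills.Theorems.BalabanUVNodesN21ChartRoadWindowVacuity
import Summits.QuantumFields.BalabanUV.T4Continuum.Support.ShellMeasureExpHaarClosedBallSUN

/-!
# N21 (NE7c) · THE EXPONENTIAL WINDOW IS A PROPER SMALL-FIELD WINDOW: `Haar_{SU(N)} (exp B̄_S) < 1` and
# `Haar_{SU(N)} (g · exp B̄_S) < 1` for every `N ≥ 2`, every radius `S ≤ π` and every centre `g` — the letter `hq` of
# dag-n21-w2's LOCATED-1 certificate (p612378) DISCHARGED, and that certificate re-issued without it

Width seat pub-ymgap-dag-n21-w1 (g3; director-ym №197 ∕ HUMAN RULING D-0149), node N21 = NE7c (NOT PRINTED in [Bałaban 1983–89], NOT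
proved), lane K3⁷ `SpineGivenEndpointR13SepCoPH` (stmt-QuantumFields-20544, `--kind proof --supports … --as helper`).  File 18 of the
seat's chain (g0 files 1–8, g2 files 9–17).  THEOREMS ONLY: 0 `def`, 0 `sorry`; count-neutral.  Imports dag-n21-w2's
`…N21ChartRoadWindowVacuity` (p612378; brings pub-balaban's `ShellMeasureScalingSUN`: `expBallSU`, `expWindowSU`, `windowSU`) and pub-balaban's
`Support.ShellMeasureExpHaarClosedBallSUN` (`abs_eigen_lt_pi`; with `ShellMeasureExpJacobianSUN`'s diagonalisation and
`ShellMeasureExpInjectiveSUN`'s principal logarithm).  NO Theses import.  Restates nothing; cites by name.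

WHY.  dag-n21-w2's A6 certificate ★★ `N21ChartJunctionKeyed.blockFibreLawOfDatum₉_eq_zero_of_window_of_siteInvariant` («the window
letter `hlaw` + printed gauge invariance at an interior site ⇒ the ZERO fibre law») DISPLAYS the letter
`hq : Haar (expWindowSU (c b₀) S) < 1` — «folklore for `S ≤ π`, as a hypothesis, because the tree's `HaarData` is an abstract invariant
probability».  On `SU(N)` the tree's `HaarData` IS Mathlib's normalised Haar measure (`UnitaryModel.instHaarDataSpecialUnitaryGroup` =
`HaarData.ofCompactGroup`, `haar := Measure.haarMeasure ⊤`), which charges every non-empty open set; and the exponential image of the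
closed Hilbert–Schmidt `π`-ball of `𝔰𝔲(N)` is a compact set MISSING every element of `SU(N)` with an eigenvalue `−1` — such elements
exist as soon as `N ≥ 2` (at `N = 1` the window is the whole (trivial) group and the letter is FALSE, so `2 ≤ N` is displayed).

WHAT IS PROVED ([folklore] linear algebra + Haar-measure facts; every pub-balaban module credited by name).
* §1 `det_conjDiag` (`det (U·diag d·U*) = ∏ d`), `conjDiag_add_one`, `cexp_mul_I_add_one_ne_zero` (`|t| < π ⇒ e^{it} + 1 ≠ 0`, principal
  logarithm `log(−1) = iπ`), ★ `det_coe_expPtSU_add_one_ne_zero`: for `‖v‖_HS ≤ π`, `det (exp (genSU v) + 1) = ∏_k (e^{iθ_k} + 1) ≠ 0`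
  (`exp (genSU v) = U·diag(e^{iθ})·U*`, `ShellMeasureExpJacobianSUN.exp_genSU_eq_conjDiag`; `|θ_k| < π`, `…ClosedBallSUN.abs_eigen_lt_pi`) —
  NO CHART POINT OF THE CLOSED `π`-BALL HAS EIGENVALUE `−1`.
* §2 ★ `exists_not_mem_expBallSU` (`2 ≤ N ⇒ ∃ U : SU(N), U ∉ expBallSU π`; the witness `diag(−1,−1,1,…,1)` is built INLINE — no `def`),
  `expBallSU_mono`, `isCompact_expBallSU`, `exists_not_mem_expWindowSU`.
* §3 `haar_isOpenPosMeasure` (the tree's Haar on `SU(N)` charges open sets), `haar_compl_expBallSU_pos`, ★★ `haar_expBallSU_lt_one`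
  (`2 ≤ N`, `S ≤ π`), `haar_expWindowSU_eq` (EVERY `g`, `S`: `Haar (expWindowSU g S) = Haar (expBallSU S)`, left invariance
  `HaarData.map_mul_left` + `preimage_mul_expWindowSU`), ★★ `haar_expWindowSU_lt_one`.
* §4 JUNCTION BY NAME: ★★′ `blockFibreLawOfDatum₉_eq_zero_of_window_of_siteInvariant_of_le_pi` = dag-n21-w2's ★★ with `hq` DISCHARGED
  (binders `2 ≤ N`, `S ≤ π` displayed instead; every other binder verbatim) + the (M1)-junk corollary
  `slotAntiConcentration_blockFibreLaw_of_window_of_siteInvariant_of_le_pi`.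
* §5 A2 (tightness of `2 ≤ N`): `eq_one_of_rank_one` (`SU(1)` is trivial), `expBallSU_rank_one_eq_univ`, `haar_expBallSU_rank_one` — at `N = 1` the
  window of every radius `S ≥ 0` is the whole group, Haar mass `1`.

HONEST FRAMING.  [folklore] over pub-balaban's chart modules BY NAME; it removes ONE displayed letter from an A6 vacuity certificate of the chart
road and types nothing of Bałaban's; the printed gauge invariance `hinv` of the dressed fibre density stays a HYPOTHESIS; (M1) ∕ NE7c NOT
PRINTED ∕ NOT proved; **N21 NOT discharged**; K3⁷ NOT claimed; counts unmoved (typed 28∕28 · discharged 5∕27); never a count claim; one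
finite 𝕋⁴ at fixed ε — R4 would close only the conditional finite-𝕋⁴ rung `BalabanLadder.UV`, NOT the Yang–Mills mass gap (Clay); nothing
about ℝ⁴ ∕ OS.  No decl below carries a cite tag.
-/

set_option autoImplicit false

noncomputable section

open scoped BigOperators ENNReal
open MeasureTheory Set Function Metric Matrix
open Complex (I)

namespace Summit.QuantumFields.YangMills.Theorems.N21ExpWindowHaarMassLtOne

open Literature.MathematicalPhysics.QuantumFieldTheory.Balaban1983to89
open Summit.QuantumFields.BalabanUV.T4Continuum
open Summit.QuantumFields.BalabanUV.T4Continuum.ShellMeasureExpChartSUN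
  (SUN ChartSU genSU expPtSU coe_expPtSU continuous_expPtSU)
open Summit.QuantumFields.BalabanUV.T4Continuum.ShellMeasureVandermondeSUN (conjDiag conjDiag_one coe_mul_star_coe)
open Summit.QuantumFields.BalabanUV.T4Continuum.ShellMeasureExpInjectiveSUN (conjDiag_add log_cexp_mul_I)
open Summit.QuantumFields.BalabanUV.T4Continuum.ShellMeasureExpJacobianSUN (herm exists_conjDiag exp_genSU_eq_conjDiag)
open Summit.QuantumFields.BalabanUV.T4Continuum.ShellMeasureExpHaarClosedBallSUN (abs_eigen_lt_pi)
open Summit.QuantumFields.BalabanUV.T4Continuum.ShellMeasureScalingSUN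
  (expBallSU expWindowSU measurableSet_expBallSU measurableSet_expWindowSU preimage_mul_expWindowSU)

variable {N : ℕ}

/-! ## §1 No chart point of the closed Hilbert–Schmidt `π`-ball has eigenvalue `−1` -/

section Algebra

/-- `det (U · diag d · U*) = ∏_k d_k` (`det U · det U* = det (U U*) = 1`). [folklore] -/
theorem det_conjDiag (U : Matrix.unitaryGroup (Fin N) ℂ) (d : Fin N → ℂ) : (conjDiag U d).det = ∏ k, d k := by
  unfold conjDiag
  rw [det_mul, det_mul, det_diagonal]
  have h : (U : Matrix (Fin N) (Fin N) ℂ).det * (star (U : Matrix (Fin N) (Fin N) ℂ)).det = 1 := by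
    rw [← det_mul, coe_mul_star_coe, det_one]
  calc (U : Matrix (Fin N) (Fin N) ℂ).det * (∏ k, d k) * (star (U : Matrix (Fin N) (Fin N) ℂ)).det
      = (U : Matrix (Fin N) (Fin N) ℂ).det * (star (U : Matrix (Fin N) (Fin N) ℂ)).det * ∏ k, d k := by ring
    _ = ∏ k, d k := by rw [h, one_mul]

/-- `U · diag d · U* + 1 = U · diag (d + 1) · U*`. [folklore] -/
theorem conjDiag_add_one (U : Matrix.unitaryGroup (Fin N) ℂ) (d : Fin N → ℂ) :
    conjDiag U d + 1 = conjDiag U fun k => d k + 1 := by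
  rw [show (fun k => d k + 1) = d + 1 from rfl, conjDiag_add, conjDiag_one]

/-- `|t| < π ⇒ e^{it} + 1 ≠ 0`: if `e^{it} = −1` then the principal logarithm gives `it = log(−1) = iπ`. [folklore] -/
theorem cexp_mul_I_add_one_ne_zero {t : ℝ} (ht : |t| < Real.pi) : Complex.exp (t * I) + 1 ≠ 0 := by
  intro h
  have h1 : Complex.exp (t * I) = -1 := eq_neg_of_add_eq_zero_left h
  have h2 : Complex.log (Complex.exp (t * I)) = t * I := log_cexp_mul_I ht
  rw [h1, Complex.log_neg_one] at h2
  have h3 : (Real.pi : ℂ) = t := mul_right_cancel₀ Complex.I_ne_zero h2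
  have h4 : Real.pi = t := by exact_mod_cast h3
  rw [← h4, abs_of_pos Real.pi_pos] at ht
  exact lt_irrefl _ ht

/-- ★ **NO CHART POINT OF THE CLOSED `π`-BALL HAS EIGENVALUE `−1`**: for `‖v‖_HS ≤ π`,
`det (exp (genSU v) + 1) = ∏_k (e^{iθ_k} + 1) ≠ 0` (diagonalisation `exp (genSU v) = U·diag(e^{iθ})·U*` with all `|θ_k| < π`).
[folklore] -/
theorem det_coe_expPtSU_add_one_ne_zero {v : ChartSU N} (hv : ‖v‖ ≤ Real.pi) :
    (((expPtSU v : SUN N) : Matrix (Fin N) (Fin N) ℂ) + 1).det ≠ 0 := by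
  obtain ⟨U, θ, h⟩ := exists_conjDiag v
  rw [coe_expPtSU, exp_genSU_eq_conjDiag h, conjDiag_add_one, det_conjDiag]
  exact Finset.prod_ne_zero_iff.mpr fun k _ => cexp_mul_I_add_one_ne_zero (abs_eigen_lt_pi h hv k)

end Algebra

/-! ## §2 A witness outside the window: `diag(−1,−1,1,…,1) ∈ SU(N)`, `N ≥ 2` -/

section Witness

/-- ★ **THE EXPONENTIAL IMAGE OF THE CLOSED `π`-BALL IS A PROPER SUBSET OF `SU(N)` FOR `N ≥ 2`**: the diagonal matrix with
entries `−1, −1, 1, …, 1` is special unitary and has `det (· + 1) = 0`, so by §1 it is no `expPtSU v` with `‖v‖ ≤ π`.  (At `N = 1`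
the group is trivial and the window is everything — the bound `2 ≤ N` is needed.)  The witness is built inline; no `def`. [folklore] -/
theorem exists_not_mem_expBallSU (hN : 2 ≤ N) : ∃ U : SUN N, U ∉ expBallSU Real.pi := by
  let i₀ : Fin N := ⟨0, by omega⟩
  let i₁ : Fin N := ⟨1, by omega⟩
  have hne : i₁ ≠ i₀ := fun h => by
    have := congrArg Fin.val h
    simp [i₀, i₁] at this
  let d : Fin N → ℂ := fun i => if i = i₀ ∨ i = i₁ then -1 else 1
  have hd : ∀ i, d i = -1 ∨ d i = 1 := fun i => by
    by_cases hi : i = i₀ ∨ i = i₁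
    · exact Or.inl (if_pos hi)
    · exact Or.inr (if_neg hi)
  have hd₀ : d i₀ = -1 := if_pos (Or.inl rfl)
  have hd₁ : d i₁ = -1 := if_pos (Or.inr rfl)
  -- unitary
  have hunit : diagonal d ∈ Matrix.unitaryGroup (Fin N) ℂ := by
    rw [Matrix.mem_unitaryGroup_iff, star_eq_conjTranspose, diagonal_conjTranspose, diagonal_mul_diagonal]
    have h1 : (fun i => d i * star (d i)) = fun _ => (1 : ℂ) := by
      funext i
      rcases hd i with h | h <;> simp [h]
    rw [show (fun i => d i * star d i) = fun i => d i * star (d i) from rfl, h1, diagonal_one]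
  -- determinant one
  have hdet : (diagonal d).det = 1 := by
    rw [det_diagonal, ← Finset.mul_prod_erase _ _ (Finset.mem_univ i₀),
      ← Finset.mul_prod_erase _ _ (Finset.mem_erase.mpr ⟨hne, Finset.mem_univ i₁⟩),
      Finset.prod_eq_one (fun i hi => ?_), hd₀, hd₁]
    · norm_num
    · obtain ⟨hi1, hi⟩ := Finset.mem_erase.mp hi
      obtain ⟨hi0, _⟩ := Finset.mem_erase.mp hi
      exact if_neg (not_or.mpr ⟨hi0, hi1⟩)
  refine ⟨⟨diagonal d, Matrix.mem_specialUnitaryGroup_iff.mpr ⟨hunit, hdet⟩⟩, ?_⟩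
  rintro ⟨v, hv, hvU⟩
  have hvπ : ‖v‖ ≤ Real.pi := mem_closedBall_zero_iff.mp hv
  have hmat : ((expPtSU v : SUN N) : Matrix (Fin N) (Fin N) ℂ) = diagonal d := congrArg Subtype.val hvU
  have hzero : (diagonal d + 1).det = 0 := by
    rw [← diagonal_one, diagonal_add, det_diagonal]
    exact Finset.prod_eq_zero (Finset.mem_univ i₁) (by rw [hd₁]; norm_num)
  exact det_coe_expPtSU_add_one_ne_zero hvπ (by rw [hmat]; exact hzero)

/-- the exponential image balls are monotone in the radius. [folklore] -/
theorem expBallSU_mono {S S' : ℝ} (h : S ≤ S') : expBallSU (N := N) S ⊆ expBallSU S' :=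
  image_mono (closedBall_subset_closedBall h)

/-- the exponential image ball is compact (continuous image of a compact ball). [folklore] -/
theorem isCompact_expBallSU (S : ℝ) : IsCompact (expBallSU (N := N) S) :=
  (isCompact_closedBall (0 : ChartSU N) S).image continuous_expPtSU

/-- … hence for `N ≥ 2` and `S ≤ π` some element of `SU(N)` lies outside `expBallSU S`. [folklore] -/
theorem exists_not_mem_expBallSU_of_le (hN : 2 ≤ N) {S : ℝ} (hS : S ≤ Real.pi) : ∃ U : SUN N, U ∉ expBallSU S := by
  obtain ⟨U, hU⟩ := exists_not_mem_expBallSU hN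
  exact ⟨U, fun h => hU (expBallSU_mono hS h)⟩

/-- … and some element lies outside every WINDOW `g · expBallSU S` (translate the witness). [folklore] -/
theorem exists_not_mem_expWindowSU_of_le (hN : 2 ≤ N) (g : SUN N) {S : ℝ} (hS : S ≤ Real.pi) :
    ∃ U : SUN N, U ∉ expWindowSU g S := by
  obtain ⟨U, hU⟩ := exists_not_mem_expBallSU_of_le hN hS
  refine ⟨g * U, fun h => hU ?_⟩
  rw [← preimage_mul_expWindowSU g S]
  exact h

end Witness

/-! ## §3 Haar mass of the window: `< 1` -/

section Haar

variable [NeZero N]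

/-- the tree's Haar data on `SU(N)` is Mathlib's normalised Haar measure, which charges every non-empty open set. [folklore] -/
theorem haar_isOpenPosMeasure : (HaarData.haar : Measure (SUN N)).IsOpenPosMeasure := by
  show (Measure.haarMeasure (⊤ : TopologicalSpace.PositiveCompacts (SUN N))).IsOpenPosMeasure
  infer_instance

/-- the complement of the exponential image ball has POSITIVE Haar mass (`N ≥ 2`, `S ≤ π`): it is open (the ball's image is compact)
and non-empty (§2). [folklore] -/
theorem haar_compl_expBallSU_pos (hN : 2 ≤ N) {S : ℝ} (hS : S ≤ Real.pi) :
    0 < (HaarData.haar : Measure (SUN N)) (expBallSU S)ᶜ := by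
  haveI := haar_isOpenPosMeasure (N := N)
  obtain ⟨U, hU⟩ := exists_not_mem_expBallSU_of_le (N := N) hN hS
  exact (isCompact_expBallSU S).isClosed.isOpen_compl.measure_pos _ ⟨U, hU⟩

/-- ★★ **THE EXPONENTIAL WINDOW HAS HAAR MASS `< 1`**: for every `N ≥ 2` and every radius `S ≤ π`,
`Haar_{SU(N)} (expBallSU S) < 1`. [folklore] -/
theorem haar_expBallSU_lt_one (hN : 2 ≤ N) {S : ℝ} (hS : S ≤ Real.pi) :
    (HaarData.haar : Measure (SUN N)) (expBallSU S) < 1 := by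
  haveI : IsProbabilityMeasure (HaarData.haar : Measure (SUN N)) := HaarData.isProb
  have hadd : (HaarData.haar : Measure (SUN N)) (expBallSU S) + (HaarData.haar : Measure (SUN N)) (expBallSU S)ᶜ = 1 := by
    rw [measure_add_measure_compl (measurableSet_expBallSU S), measure_univ]
  calc (HaarData.haar : Measure (SUN N)) (expBallSU S)
      < (HaarData.haar : Measure (SUN N)) (expBallSU S) + (HaarData.haar : Measure (SUN N)) (expBallSU S)ᶜ :=
        ENNReal.lt_add_right (measure_ne_top _ _) (haar_compl_expBallSU_pos hN hS).ne'
    _ = 1 := hadd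

/-- **HAAR MASS OF THE WINDOW ABOUT ANY CENTRE EQUALS THAT OF THE IMAGE BALL** (every `g`, every `S`; left invariance of the tree's
`HaarData.haar` and `preimage_mul_expWindowSU`). [folklore] -/
theorem haar_expWindowSU_eq (g : SUN N) (S : ℝ) :
    (HaarData.haar : Measure (SUN N)) (expWindowSU g S) = (HaarData.haar : Measure (SUN N)) (expBallSU S) := by
  conv_lhs => rw [← HaarData.map_mul_left (G := SUN N) g]
  rw [Measure.map_apply (ShellMeasureScalingSUN.measurable_mul_left g) (measurableSet_expWindowSU g S),
    preimage_mul_expWindowSU]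

/-- ★★ **EVERY WINDOW `g · exp B̄_S` HAS HAAR MASS `< 1`** (`N ≥ 2`, `S ≤ π`) — the letter `hq` of dag-n21-w2's LOCATED-1 certificate,
as a theorem. [folklore] -/
theorem haar_expWindowSU_lt_one (hN : 2 ≤ N) (g : SUN N) {S : ℝ} (hS : S ≤ Real.pi) :
    (HaarData.haar : Measure (SUN N)) (expWindowSU g S) < 1 := by
  rw [haar_expWindowSU_eq]
  exact haar_expBallSU_lt_one hN hS

/-- the complement of every window has positive Haar mass (`N ≥ 2`, `S ≤ π`). [folklore] -/
theorem haar_compl_expWindowSU_pos (hN : 2 ≤ N) (g : SUN N) {S : ℝ} (hS : S ≤ Real.pi) :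
    0 < (HaarData.haar : Measure (SUN N)) (expWindowSU g S)ᶜ := by
  haveI : IsProbabilityMeasure (HaarData.haar : Measure (SUN N)) := HaarData.isProb
  rw [prob_compl_eq_one_sub (measurableSet_expWindowSU g S)]
  exact tsub_pos_of_lt (haar_expWindowSU_lt_one hN g hS)

end Haar

/-! ## §4 Junction BY NAME: dag-n21-w2's LOCATED-1 certificate with `hq` discharged -/

section AtRecord

open Literature.MathematicalPhysics.QuantumFieldTheory.Balaban1983to89.T4Continuum
open Literature.MathematicalPhysics.QuantumFieldTheory.Balaban1983to89.Node00 hiding dimSU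
open T4ShellMeasure (SlotAntiConcentration)
open T4ShellMeasureDet (blockLaw)
open N21ShellSplitOfRecord13CoPH (cubeDensityOfDatum₉ blockFibreLawOfDatum₉)
open N21ChartJunctionKeyed (blockFibreLawOfDatum₉_eq_zero_of_window_of_siteInvariant slotAntiConcentration_of_measure_eq_zero)
open Summit.QuantumFields.BalabanUV.T4Continuum.ShellMeasureScalingSUN (windowSU)

variable (F : T4Family) (N' : ℕ) [NeZero N'] (ϑ : Stage9Params F N') (Dt : FiniteEpsData F (SUN N')) (g₀ : ℕ → ℝ)
  (os : List (ULoop F)) (p : B12.RunParams) (g : ℕ → ℝ) (k : ℕ)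

/-- ★★′ **THE WINDOW LETTER AND SITE INVARIANCE FORCE THE ZERO FIBRE LAW — `hq` DISCHARGED.**  dag-n21-w2's
`N21ChartJunctionKeyed.blockFibreLawOfDatum₉_eq_zero_of_window_of_siteInvariant` (p612378) with its displayed letter
`hq : Haar (expWindowSU (c b₀) S) < 1` REPLACED by the binders `2 ≤ N` and `S ≤ π` (§3 ★★ `haar_expWindowSU_lt_one`); every other binder —
(H-U), (H-ζ), averaging measurability, the window factorisation `hlaw`, the out-∕in-bond sets with `b₀ ∈ O`, the printed gauge invariance `hinv`
(a HYPOTHESIS) — verbatim. [bookkeeping] -/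
theorem blockFibreLawOfDatum₉_eq_zero_of_window_of_siteInvariant_of_le_pi (hN : 2 ≤ N')
    (hU : LocalBgMeasurable F N' ϑ.ν) (hζm : ZetaMeasurable F N' ϑ.ζ) (hD : Dt.AvgMeasurable) (t : ℝ)
    (a : ↥(cubeIndices (F.P p.K) (cubeSide (F.P p.K).L ϑ.ν.M₂ (RkOfRecord (F.P p.K).L ϑ.ν.r (g k)) k)))
    (b : Finset (PBond (F.P p.K) k)) (x : GaugeField (F.P p.K) k (SUN N'))
    {S : ℝ} (hSπ : S ≤ Real.pi) (c : GaugeField (F.P p.K) k (SUN N')) (R : (↥b → SUN N') → ℝ≥0∞)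
    (hlaw : blockFibreLawOfDatum₉ F N' ϑ Dt g₀ os p g k t a b x = (blockLaw b).withDensity fun y => windowSU b c S y * R y)
    (O I : Finset ↥b) {b₀ : ↥b} (hb₀ : b₀ ∈ O)
    (hinv : ∀ (h : SUN N') (y : ↥b → SUN N'), letI := Classical.decEq (PBond (F.P p.K) k)
      cubeDensityOfDatum₉ F N' ϑ Dt g₀ os p g k t a
          (Function.updateFinset x b fun i : ↥b =>
            (if i ∈ O then (fun u : SUN N' => h * u) else if i ∈ I then (fun u : SUN N' => u * h⁻¹) else id) (y i)) =
        cubeDensityOfDatum₉ F N' ϑ Dt g₀ os p g k t a (Function.updateFinset x b y)) :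
    blockFibreLawOfDatum₉ F N' ϑ Dt g₀ os p g k t a b x = 0 :=
  blockFibreLawOfDatum₉_eq_zero_of_window_of_siteInvariant F N' ϑ Dt g₀ os p g k hU hζm hD t a b x S c R hlaw O I hb₀ hinv
    (haar_expWindowSU_lt_one hN (c b₀) hSπ)

/-- COROLLARY: under the same letters (M1) for the block fibre law holds for EVERY statistic and EVERY `θ ρ D` — only as the junk
instance of the ZERO law; `hq` discharged as above. [bookkeeping] -/
theorem slotAntiConcentration_blockFibreLaw_of_window_of_siteInvariant_of_le_pi (hN : 2 ≤ N')
    (hU : LocalBgMeasurable F N' ϑ.ν) (hζm : ZetaMeasurable F N' ϑ.ζ) (hD : Dt.AvgMeasurable) (t : ℝ)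
    (a : ↥(cubeIndices (F.P p.K) (cubeSide (F.P p.K).L ϑ.ν.M₂ (RkOfRecord (F.P p.K).L ϑ.ν.r (g k)) k)))
    (b : Finset (PBond (F.P p.K) k)) (x : GaugeField (F.P p.K) k (SUN N'))
    {S : ℝ} (hSπ : S ≤ Real.pi) (c : GaugeField (F.P p.K) k (SUN N')) (R : (↥b → SUN N') → ℝ≥0∞)
    (hlaw : blockFibreLawOfDatum₉ F N' ϑ Dt g₀ os p g k t a b x = (blockLaw b).withDensity fun y => windowSU b c S y * R y)
    (O I : Finset ↥b) {b₀ : ↥b} (hb₀ : b₀ ∈ O)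
    (hinv : ∀ (h : SUN N') (y : ↥b → SUN N'), letI := Classical.decEq (PBond (F.P p.K) k)
      cubeDensityOfDatum₉ F N' ϑ Dt g₀ os p g k t a
          (Function.updateFinset x b fun i : ↥b =>
            (if i ∈ O then (fun u : SUN N' => h * u) else if i ∈ I then (fun u : SUN N' => u * h⁻¹) else id) (y i)) =
        cubeDensityOfDatum₉ F N' ϑ Dt g₀ os p g k t a (Function.updateFinset x b y))
    (u : (↥b → SUN N') → ℝ) (θ ρ D : ℝ) :
    SlotAntiConcentration (blockFibreLawOfDatum₉ F N' ϑ Dt g₀ os p g k t a b x) u θ ρ D :=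
  slotAntiConcentration_of_measure_eq_zero
    (blockFibreLawOfDatum₉_eq_zero_of_window_of_siteInvariant_of_le_pi F N' ϑ Dt g₀ os p g k hN hU hζm hD t a b x hSπ c R
      hlaw O I hb₀ hinv) u θ ρ D

end AtRecord

/-! ## §5 A2: the binder `2 ≤ N` cannot be dropped — at `N = 1` the window is the whole group -/

section RankOne

open Summit.QuantumFields.BalabanUV.T4Continuum.ShellMeasureExpChartSUN (expPtSU_zero)

/-- `SU(1)` is the trivial group: every element is `1` (its only entry is its determinant). [folklore] -/
theorem eq_one_of_rank_one (U : SUN 1) : U = 1 := by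
  apply Subtype.ext
  have hdet : (U : Matrix (Fin 1) (Fin 1) ℂ).det = 1 := (Matrix.mem_specialUnitaryGroup_iff.mp U.2).2
  rw [Matrix.det_fin_one] at hdet
  ext i j
  fin_cases i; fin_cases j
  simpa using hdet

/-- A2 WITNESS: at `N = 1` the exponential image ball of every radius `S ≥ 0` is ALL of `SU(1)` … [folklore] -/
theorem expBallSU_rank_one_eq_univ {S : ℝ} (hS : 0 ≤ S) : expBallSU (N := 1) S = univ := by
  refine eq_univ_of_forall fun U => ?_
  rw [eq_one_of_rank_one U, ← expPtSU_zero]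
  exact mem_image_of_mem _ (mem_closedBall_zero_iff.mpr (by rwa [norm_zero]))

/-- … so its Haar mass is `1`, not `< 1`: the binder `2 ≤ N` of §3 ★★ cannot be dropped. [folklore] -/
theorem haar_expBallSU_rank_one {S : ℝ} (hS : 0 ≤ S) : (HaarData.haar : Measure (SUN 1)) (expBallSU S) = 1 := by
  haveI : IsProbabilityMeasure (HaarData.haar : Measure (SUN 1)) := HaarData.isProb
  rw [expBallSU_rank_one_eq_univ hS, measure_univ]

end RankOne

end Summit.QuantumFields.YangMills.Theorems.N21ExpWindowHaarMassLtOne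

end
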